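import Summits.AtomisticToContinuum.HydrodynamicLimit.Theorems.CollisionIsometryCLTMacroClosureTwoScaleDefs
import Summits.AtomisticToContinuum.HydrodynamicLimit.Theorems.CollisionIsometryCLTMacroClosureTwoScaleJensenPoint
import Summits.AtomisticToContinuum.HydrodynamicLimit.Theses.StiffCollisionalRelaxation
import HarnessLib

/-!
# Jensen inequality for the box-smoothed block, integrated over the torus (input of `stub_blockMGF_twoScale`,
line `IdeatorTwoGen1Sketch`, crux `MacroClosure`, stmt-AtomisticToContinuum-14870)

Proof file (`--supports stmt-AtomisticToContinuum-14870`) for the registered stub `Barycentric.stub_twoScale_jensen`: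
integrating the landed pointwise inequality `stub_twoScale_jensenPoint`,
`h⁺(Ū_{b⋆ψ}(z,x) | U_c) ≤ ∫ ψ(w) h⁺(Ū_b(z,x+w) | U_c) dw` (`b = boxKernel ℓ`, `ψ = Torus.kernel δ`), over
`x ∈ 𝕋³` gives `∫ₓ h⁺(Ū_{b⋆ψ}(z,x) | U_c) dx ≤ ∫ₓ h⁺(Ū_b(z,x) | U_c) dx`:

* `Jensen.measurable_comp_of_finite` — the shifted-box integrand `g(y) = h⁺(Ū_b(z,y) | U_c)` factors through
  the cell index set `y ↦ cellSet ℓ z y` (finitely many values on measurable level sets,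
  `JensenPoint.bU_boxKernel`, `JensenPoint.measurableSet_cellSet_eq`), hence is measurable and bounded, so
  integrable on the probability space `𝕋³` (the second conjunct);
* `Jensen.integral_integral_mul_comp_add` — Fubini on `𝕋³ × 𝕋³` and translation invariance of the Haar
  measure: `∫ₓ ∫_w ψ(w) g(x + w) dw dx = (∫ ψ) ∫ g = ∫ g` (`Torus.integral_kernel`);
* `Jensen.integral_le_of_forall_le_average` — monotonicity of the integral (if the left integrand is not
  integrable its Bochner integral is `0 ≤ ∫ g`).
-/

noncomputable section

open MeasureTheory Filter Set Topology InformationTheory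
open scoped ENNReal ContDiff Convolution

namespace Summit.AtomisticToContinuum.HydrodynamicLimit.Theorems.MacroClosureLine

open Literature.MathematicalPhysics.KineticTheory Literature.Analysis.FluidPDE
open Literature.Analysis.FunctionSpaces
open Summit.AtomisticToContinuum.HydrodynamicLimit.Theses

namespace Barycentric

namespace Jensen

/-- A real function on `𝕋³` that factors through a finitely-valued map with measurable level sets is
measurable (it is a finite sum of indicators). [folklore] -/
theorem measurable_comp_of_finite {P : Type*} [Fintype P] (S : T3 → P) (G : P → ℝ)
    (hS : ∀ T, MeasurableSet {y | S y = T}) : Measurable fun y => G (S y) := by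
  classical
  have hpt : (fun y => G (S y)) = fun y => ∑ T, {y' | S y' = T}.indicator (fun _ => G T) y := by
    funext y
    rw [Finset.sum_eq_single_of_mem (S y) (Finset.mem_univ _)]
    · rw [Set.indicator_of_mem (show y ∈ {y' | S y' = S y} from rfl)]
    · intro T _ hT
      exact Set.indicator_of_notMem (fun h : S y = T => hT h.symm) _
  rw [hpt]
  exact Finset.measurable_sum _ fun T _ => measurable_const.indicator (hS T)

/-- **Fubini and translation invariance**: for a bounded measurable `g` and a continuous `ψ` on `𝕋³`,
`(x, w) ↦ ψ(w) g(x + w)` is integrable on `𝕋³ × 𝕋³` and `∫ₓ ∫_w ψ(w) g(x + w) dw dx = (∫ ψ) (∫ g)`. [folklore] -/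
theorem integral_integral_mul_comp_add {g ψ : T3 → ℝ} (hg : Measurable g) {C : ℝ}
    (hC : ∀ y, ‖g y‖ ≤ C) (hψ : Continuous ψ) :
    Integrable (Function.uncurry fun x w => ψ w * g (x + w)) ((volume : Measure T3).prod volume) ∧
      ∫ x, ∫ w, ψ w * g (x + w) = (∫ w, ψ w) * ∫ y, g y := by
  obtain ⟨Cψ, hCψ⟩ := Torus.exists_forall_norm_le_of_continuous hψ
  have hm : Measurable (Function.uncurry fun x w : T3 => ψ w * g (x + w)) :=
    (hψ.measurable.comp measurable_snd).mul (hg.comp (measurable_fst.add measurable_snd))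
  have hI : Integrable (Function.uncurry fun x w => ψ w * g (x + w))
      ((volume : Measure T3).prod volume) := by
    refine Integrable.of_bound hm.aestronglyMeasurable (Cψ * C) (Eventually.of_forall fun p => ?_)
    rw [Function.uncurry_def, norm_mul]
    exact mul_le_mul (hCψ _) (hC _) (norm_nonneg _) ((norm_nonneg _).trans (hCψ p.2))
  refine ⟨hI, ?_⟩
  rw [integral_integral_swap hI]
  have h1 : ∀ w, ∫ x, ψ w * g (x + w) = ψ w * ∫ y, g y := fun w => by
    rw [integral_const_mul, integral_add_right_eq_self g w]
  simp_rw [h1]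
  exact integral_mul_const _ _

/-- **Abstract integrated Jensen step**: if `g = G ∘ S` factors through a finitely-valued map with
measurable level sets, `G ≥ 0`, `ψ` is continuous with unit mass and `h ≤ ∫ ψ(w) g(· + w) dw` pointwise,
then `∫ h ≤ ∫ g` and `g` is integrable. [folklore] -/
theorem integral_le_of_forall_le_average {P : Type*} [Fintype P] (S : T3 → P) (G : P → ℝ)
    (hS : ∀ T, MeasurableSet {y | S y = T}) (hG0 : ∀ T, 0 ≤ G T) {ψ h g : T3 → ℝ}
    (hψ : Continuous ψ) (hψ1 : ∫ w, ψ w = 1) (hgS : ∀ y, g y = G (S y))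
    (hpt : ∀ x, h x ≤ ∫ w, ψ w * g (x + w)) :
    (∫ x, h x) ≤ (∫ y, g y) ∧ Integrable g := by
  have hg : g = fun y => G (S y) := funext hgS
  have hgm : Measurable g := hg ▸ measurable_comp_of_finite S G hS
  have hg0 : ∀ y, 0 ≤ g y := fun y => (hgS y) ▸ hG0 (S y)
  have hgC : ∀ y, ‖g y‖ ≤ ∑ T, G T := fun y => by
    rw [Real.norm_eq_abs, abs_of_nonneg (hg0 y), hgS y]
    exact Finset.single_le_sum (fun T _ => hG0 T) (Finset.mem_univ (S y))
  have hgi : Integrable g :=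
    Integrable.of_bound hgm.aestronglyMeasurable _ (Eventually.of_forall hgC)
  obtain ⟨hI, hF⟩ := integral_integral_mul_comp_add hgm hgC hψ
  rw [hψ1, one_mul] at hF
  refine ⟨?_, hgi⟩
  by_cases hh : Integrable h
  · rw [← hF]
    exact integral_mono hh hI.integral_prod_left hpt
  · rw [integral_undef hh]
    exact integral_nonneg hg0

end Jensen

open JensenPoint Jensen in
/-- **Jensen for the box-smoothed block, integrated** (registered stub `stub_twoScale_jensen`): for the box
kernel of side `ℓ ∈ (0,1]` mollified by `Torus.kernel δ`, `δ ∈ (0,1/4]`, a configuration with pairwise distinct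
velocities, at least two particles and packing `< 11/10` in every cube of side `ℓ`, and any homogeneous
reference state, `∫ₓ h_σ⁺(Ū_{b⋆ψ}(z,x) | U_c) dx ≤ ∫ₓ h_σ⁺(Ū_b(z,x) | U_c) dx`, and the right integrand is
integrable (pointwise Jensen `stub_twoScale_jensenPoint`, Fubini, translation invariance, `∫ ψ = 1`). [folklore] -/
theorem stub_twoScale_jensen : StiffCollisionalRelaxation.HsFreeEnergyConvex → ∀ (σ : ℝ), 0 < σ →
    ∀ (uc : V3) (θc : ℝ) (N : ℕ) (ℓ δ : ℝ), 0 < ℓ → ℓ ≤ 1 → 0 < δ → δ ≤ 1 / 4 →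
    ∀ (z : Config (N + 1) (Fin 3) T3), (∀ i j, i ≠ j → (z i).2 ≠ (z j).2) →
    (∀ y, 2 ≤ cellCount ℓ z y) →
    (∀ y, (cellCount ℓ z y : ℝ) * σ ^ 3 < 11 / 10 * (((N : ℝ) + 1) * ℓ ^ 3)) →
    (∫ x, max 0 (relEnt σ (bU (boxKernel ℓ ⋆ (Torus.kernel δ : T3 → ℝ)) z x) (stateOf 1 uc θc)) ≤
      ∫ x, max 0 (relEnt σ (bU (boxKernel ℓ) z x) (stateOf 1 uc θc))) ∧
    Integrable (fun x => max 0 (relEnt σ (bU (boxKernel ℓ) z x) (stateOf 1 uc θc))) := by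
  intro hH σ hσ uc θc N ℓ δ hℓ hℓ1 hδ hδ4 z hv h2 hpack
  set F : Finset (Fin (N + 1)) → State := fun T => ((N + 1 : ℕ) : ℝ)⁻¹ •
    ∑ i ∈ T, (ℓ ^ 3)⁻¹ • (((1 : ℝ), (z i).2, ‖(z i).2‖ ^ 2 / 2) : State)
  have hbF : ∀ y, bU (boxKernel ℓ) z y = F (cellSet ℓ z y) := fun y => bU_boxKernel ℓ z y
  exact integral_le_of_forall_le_average (cellSet ℓ z)
    (fun T => max 0 (relEnt σ (F T) (stateOf 1 uc θc)))
    (fun T => by simpa only [zero_add] using measurableSet_cellSet_eq ℓ z 0 T)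
    (fun T => le_max_left _ _) (Torus.continuous_kernel hδ hδ4) (Torus.integral_kernel hδ hδ4)
    (fun y => by rw [hbF])
    (stub_twoScale_jensenPoint hH σ hσ uc θc N ℓ δ hℓ hℓ1 hδ hδ4 z hv h2 hpack)

end Barycentric

end Summit.AtomisticToContinuum.HydrodynamicLimit.Theorems.MacroClosureLine

end
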